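import Literature.NumberTheory.Rogawski1990.ArchCompactPlaceCentralLimitFormula   -- ★ p842290 (this seat): the angle chart `mul_exp_arg_div_eq`, `continuousAt_arg_div_const`
import Literature.NumberTheory.Rogawski1990.ArchCentralLimitRegularFilter         -- ★ (F0P3a-p06): `circleExp_ne_of_sub_small`
import HarnessLib

/-!
# THE ANGLE CHART AT THE CENTRE OF `(S¹)³`, WITHIN THE REGULAR SET: the (L_{U(2,1)}) letter's filter `𝓝[{z | z injective}] (ζ,ζ,ζ)` is reached from the angle filter
# `𝓝[{θ | (ζe^{iθ_k})_k injective}] 0` (Rogawski 1990 §8.4 p. 126 «continuous at γ₀ … through the regular elements»; ROAD A (A4) ∕ the N1 assembly skeleton)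

Topic `NumberTheory/Rogawski1990`; namespace `Literature.NumberTheory.Rogawski1990`.  THEOREMS ONLY (no `def`, no instance, no notation, no axiom, no named fact, no `sorry`).
Cell `pub/hodgecm-mathlib`, ENGINE T1 (crux H413 = `stmt-HodgeConjecture-24833`); ROAD-Sd, «SdArch» ED. 3's one open stub N1 = ★ `ArchCentralLimitFormulaRankTwo` (ROAD A, owner F0P3a-p05;
N1 assembly skeleton F0P3a-p02 (g12) (α1), LEAD WORD T9-8 (D)); author F0P3a-p03 (g11), 2026-09-01.  ROAD A computes `ωF_Θ` in ANGLE coordinates `θ ↦ ζ·e^{iθ}` around the centre (wall-adapted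
coordinates, ★ (A1)∕(A1′)∕(A2″)); the letter is stated in the `z`-coordinates of `(S¹)³` with the punctured-regular filter.  This file is the one-line bridge, for an ARBITRARY function `F` of the
torus point: **`tendsto_nhdsWithin_injective_of_tendsto_angleChart`** — if `θ ↦ F(ζe^{iθ})` tends to `ℓ` as `θ → 0` within the regular angles, then `F → ℓ` along `𝓝[{z | Injective z}] (ζ,ζ,ζ)`
(the local inverse `z ↦ (arg(z_k∕ζ))_k` is continuous at the centre, is a section of the chart everywhere, and preserves regularity), and the plain-filter twin `tendsto_nhds_of_tendsto_angleChart`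
(the pattern inside ★ `tendsto_letterLambda_of_posDef`, now reusable).
HONEST LABEL: HC_CM is proved only modulo the printed citations until rung 0 closes; topology bookkeeping, pays nothing by itself.

## References
* [Rogawski1990] J. D. Rogawski, *Automorphic Representations of Unitary Groups in Three Variables*, Ann. of Math. Stud. 123 (1990), §8.4 p. 126.
-/

set_option autoImplicit false

noncomputable section

open Filter Topology

namespace Literature.NumberTheory.Rogawski1990

section Chart

variable {β : Type*}

/-- **The angle chart reaches the plain neighbourhood filter of the centre**: `𝓝 (ζ,ζ,ζ) ≤ map (θ ↦ ζe^{iθ}) (𝓝 0)` (the `arg`-section ★ `mul_exp_arg_div_eq` is continuous at the centre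
★ `continuousAt_arg_div_const`). [cite: Rogawski1990, §8.4 p. 126] -/
theorem nhds_const_le_map_angleChart (ζ : Circle) :
    𝓝 (fun _ : Fin 3 => ζ) ≤ map (fun θ : Fin 3 → ℝ => fun k : Fin 3 => ζ * Circle.exp (θ k)) (𝓝 (0 : Fin 3 → ℝ)) := by
  have hsec : ∀ z : Fin 3 → Circle, (fun θ : Fin 3 → ℝ => fun k : Fin 3 => ζ * Circle.exp (θ k)) (fun k => Complex.arg (((z k : Circle) : ℂ) / (ζ : ℂ))) = z :=
    fun z => funext fun k => mul_exp_arg_div_eq ζ (z k)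
  have hψ0 : (fun k : Fin 3 => Complex.arg ((((fun _ : Fin 3 => ζ) k : Circle) : ℂ) / (ζ : ℂ))) = 0 := by
    funext k; simp only [div_self (Circle.coe_ne_zero ζ), Complex.arg_one, Pi.zero_apply]
  have hψt : Tendsto (fun z : Fin 3 → Circle => fun k : Fin 3 => Complex.arg (((z k : Circle) : ℂ) / (ζ : ℂ))) (𝓝 fun _ => ζ) (𝓝 0) := by
    have h := (continuousAt_arg_div_const ζ).tendsto
    rwa [hψ0] at h
  have hid : (fun θ : Fin 3 → ℝ => fun k : Fin 3 => ζ * Circle.exp (θ k)) ∘ (fun z : Fin 3 → Circle => fun k : Fin 3 => Complex.arg (((z k : Circle) : ℂ) / (ζ : ℂ))) = id :=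
    funext hsec
  calc 𝓝 (fun _ : Fin 3 => ζ)
      = map ((fun θ : Fin 3 → ℝ => fun k : Fin 3 => ζ * Circle.exp (θ k)) ∘ (fun z : Fin 3 → Circle => fun k : Fin 3 => Complex.arg (((z k : Circle) : ℂ) / (ζ : ℂ)))) (𝓝 fun _ => ζ) := by
        rw [hid, Filter.map_id]
    _ = map (fun θ : Fin 3 → ℝ => fun k : Fin 3 => ζ * Circle.exp (θ k)) (map (fun z : Fin 3 → Circle => fun k : Fin 3 => Complex.arg (((z k : Circle) : ℂ) / (ζ : ℂ))) (𝓝 fun _ => ζ)) :=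
        Filter.map_map.symm
    _ ≤ map (fun θ : Fin 3 → ℝ => fun k : Fin 3 => ζ * Circle.exp (θ k)) (𝓝 0) := Filter.map_mono hψt

/-- **… and the punctured-regular filter**: `𝓝[{z | z injective}] (ζ,ζ,ζ) ≤ map (θ ↦ ζe^{iθ}) (𝓝[{θ | (ζe^{iθ_k})_k injective}] 0)` — the section maps regular points to regular angles.
[cite: Rogawski1990, §8.4 p. 126] -/
theorem nhdsWithin_injective_const_le_map_angleChart (ζ : Circle) :
    𝓝[{z : Fin 3 → Circle | Function.Injective z}] (fun _ : Fin 3 => ζ) ≤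
      map (fun θ : Fin 3 → ℝ => fun k : Fin 3 => ζ * Circle.exp (θ k))
        (𝓝[{θ : Fin 3 → ℝ | Function.Injective (fun k : Fin 3 => ζ * Circle.exp (θ k))}] (0 : Fin 3 → ℝ)) := by
  have hsec : ∀ z : Fin 3 → Circle, (fun θ : Fin 3 → ℝ => fun k : Fin 3 => ζ * Circle.exp (θ k)) (fun k => Complex.arg (((z k : Circle) : ℂ) / (ζ : ℂ))) = z :=
    fun z => funext fun k => mul_exp_arg_div_eq ζ (z k)
  have hψ0 : (fun k : Fin 3 => Complex.arg ((((fun _ : Fin 3 => ζ) k : Circle) : ℂ) / (ζ : ℂ))) = 0 := by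
    funext k; simp only [div_self (Circle.coe_ne_zero ζ), Complex.arg_one, Pi.zero_apply]
  -- the section, restricted to the regular set, tends to `0` within the regular angles
  have hψw : Tendsto (fun z : Fin 3 → Circle => fun k : Fin 3 => Complex.arg (((z k : Circle) : ℂ) / (ζ : ℂ)))
      (𝓝[{z : Fin 3 → Circle | Function.Injective z}] (fun _ : Fin 3 => ζ))
      (𝓝[{θ : Fin 3 → ℝ | Function.Injective (fun k : Fin 3 => ζ * Circle.exp (θ k))}] (0 : Fin 3 → ℝ)) := by
    have hc : ContinuousWithinAt (fun z : Fin 3 → Circle => fun k : Fin 3 => Complex.arg (((z k : Circle) : ℂ) / (ζ : ℂ)))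
        {z : Fin 3 → Circle | Function.Injective z} (fun _ : Fin 3 => ζ) := (continuousAt_arg_div_const ζ).continuousWithinAt
    have hmaps : Set.MapsTo (fun z : Fin 3 → Circle => fun k : Fin 3 => Complex.arg (((z k : Circle) : ℂ) / (ζ : ℂ)))
        {z : Fin 3 → Circle | Function.Injective z} {θ : Fin 3 → ℝ | Function.Injective (fun k : Fin 3 => ζ * Circle.exp (θ k))} := by
      intro z hz
      show Function.Injective (fun k : Fin 3 => ζ * Circle.exp (Complex.arg (((z k : Circle) : ℂ) / (ζ : ℂ))))
      have h : (fun k : Fin 3 => ζ * Circle.exp (Complex.arg (((z k : Circle) : ℂ) / (ζ : ℂ)))) = z := hsec z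
      rw [h]; exact hz
    have h := hc.tendsto_nhdsWithin hmaps
    rwa [hψ0] at h
  have hid : (fun θ : Fin 3 → ℝ => fun k : Fin 3 => ζ * Circle.exp (θ k)) ∘ (fun z : Fin 3 → Circle => fun k : Fin 3 => Complex.arg (((z k : Circle) : ℂ) / (ζ : ℂ))) = id :=
    funext hsec
  calc 𝓝[{z : Fin 3 → Circle | Function.Injective z}] (fun _ : Fin 3 => ζ)
      = map ((fun θ : Fin 3 → ℝ => fun k : Fin 3 => ζ * Circle.exp (θ k)) ∘ (fun z : Fin 3 → Circle => fun k : Fin 3 => Complex.arg (((z k : Circle) : ℂ) / (ζ : ℂ))))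
          (𝓝[{z : Fin 3 → Circle | Function.Injective z}] (fun _ : Fin 3 => ζ)) := by
        rw [hid, Filter.map_id]
    _ = map (fun θ : Fin 3 → ℝ => fun k : Fin 3 => ζ * Circle.exp (θ k))
          (map (fun z : Fin 3 → Circle => fun k : Fin 3 => Complex.arg (((z k : Circle) : ℂ) / (ζ : ℂ))) (𝓝[{z : Fin 3 → Circle | Function.Injective z}] (fun _ : Fin 3 => ζ))) :=
        Filter.map_map.symm
    _ ≤ map (fun θ : Fin 3 → ℝ => fun k : Fin 3 => ζ * Circle.exp (θ k))
          (𝓝[{θ : Fin 3 → ℝ | Function.Injective (fun k : Fin 3 => ζ * Circle.exp (θ k))}] (0 : Fin 3 → ℝ)) := Filter.map_mono hψw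

/-- **ANGLE-COORDINATE REDUCTION OF THE LETTER'S FILTER**: for ANY `F : (S¹)³ → β`, if `θ ↦ F(ζe^{iθ})` tends to `ℓ` as `θ → 0` within the regular angles `{θ | (ζe^{iθ_k})_k injective}`,
then `F → ℓ` along the letter's filter `𝓝[{z | Injective z}] (ζ,ζ,ζ)` — the form in which ROAD A's wall-adapted computations of `ωF_Θ` discharge ★ `ArchCentralLimitFormulaRankTwo`.
[cite: Rogawski1990, §8.4 p. 126] -/
theorem tendsto_nhdsWithin_injective_of_tendsto_angleChart (F : (Fin 3 → Circle) → β) (ζ : Circle) (l : Filter β)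
    (h : Tendsto (fun θ : Fin 3 → ℝ => F (fun k : Fin 3 => ζ * Circle.exp (θ k)))
      (𝓝[{θ : Fin 3 → ℝ | Function.Injective (fun k : Fin 3 => ζ * Circle.exp (θ k))}] (0 : Fin 3 → ℝ)) l) :
    Tendsto F (𝓝[{z : Fin 3 → Circle | Function.Injective z}] (fun _ : Fin 3 => ζ)) l :=
  (tendsto_map'_iff.2 h).mono_left (nhdsWithin_injective_const_le_map_angleChart ζ)

/-- **… PLAIN-FILTER TWIN**: if `θ ↦ F(ζe^{iθ})` tends to `ℓ` as `θ → 0`, then `F → ℓ` as `z → (ζ,ζ,ζ)` (the pattern of ★ `tendsto_letterLambda_of_posDef` at a definite place).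
[cite: Rogawski1990, §8.4 p. 126] -/
theorem tendsto_nhds_of_tendsto_angleChart (F : (Fin 3 → Circle) → β) (ζ : Circle) (l : Filter β)
    (h : Tendsto (fun θ : Fin 3 → ℝ => F (fun k : Fin 3 => ζ * Circle.exp (θ k))) (𝓝 (0 : Fin 3 → ℝ)) l) :
    Tendsto F (𝓝 (fun _ : Fin 3 => ζ)) l :=
  (tendsto_map'_iff.2 h).mono_left (nhds_const_le_map_angleChart ζ)

/-- **THE REGULAR ANGLES NEAR `0`** are exactly the angle vectors with pairwise distinct coordinates (for `|θ_i − θ_j| < 2π`; in particular on the cube `‖θ‖ < 1`): the ROAD-A chamber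
bookkeeping reads regularity off the angles. [cite: Rogawski1990, §8.4 p. 126] -/
theorem injective_angleChart_of_injective {ζ : Circle} {θ : Fin 3 → ℝ} (hθ : Function.Injective θ) (hsmall : ∀ i j, |θ i - θ j| < 1) :
    Function.Injective (fun k : Fin 3 => ζ * Circle.exp (θ k)) := by
  intro i j hij
  have h1 : Circle.exp (θ i) = Circle.exp (θ j) := mul_left_cancel hij
  by_contra hne
  exact circleExp_ne_of_sub_small (hθ.ne hne) (hsmall i j) h1

end Chart

/-! ## ED. 2 — CHAMBER BY CHAMBER: the regular angles near `0` are the union of the six open Weyl chambers (F0P3a-p03 (g11); A-p14 (g28) census e5e8455f §1: ROAD A reaches the letter's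
filter one chamber at a time — four compact-adjacent chambers by (A1′)–(A4), two by (A5)) -/

section Chambers

variable {β : Type*}

/-- The injective angle vectors are exactly the union of the six open chambers `{θ_{σ0} < θ_{σ1} < θ_{σ2}}` (sort the coordinates: Mathlib `Tuple.sort`). [cite: Rogawski1990, §8.4 p. 126] -/
theorem setOf_injective_eq_iUnion_chamber :
    {θ : Fin 3 → ℝ | Function.Injective θ} = ⋃ σ : Equiv.Perm (Fin 3), {θ : Fin 3 → ℝ | θ (σ 0) < θ (σ 1) ∧ θ (σ 1) < θ (σ 2)} := by
  ext θ
  simp only [Set.mem_setOf_eq, Set.mem_iUnion]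
  constructor
  · intro hθ
    refine ⟨Tuple.sort θ, ?_, ?_⟩
    · exact lt_of_le_of_ne (Tuple.monotone_sort θ (by decide : (0 : Fin 3) ≤ 1))
        (fun h => absurd ((Tuple.sort θ).injective (hθ h)) (by decide))
    · exact lt_of_le_of_ne (Tuple.monotone_sort θ (by decide : (1 : Fin 3) ≤ 2))
        (fun h => absurd ((Tuple.sort θ).injective (hθ h)) (by decide))
  · rintro ⟨σ, h01, h12⟩
    have hmono : StrictMono (θ ∘ σ) := by
      refine Fin.strictMono_iff_lt_succ.2 fun i => ?_
      fin_cases i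
      · exact h01
      · exact h12
    intro i j hij
    have h := hmono.injective (a₁ := σ.symm i) (a₂ := σ.symm j) (by simpa only [Function.comp_apply, Equiv.apply_symm_apply] using hij)
    exact σ.symm.injective h

/-- **CHAMBER BY CHAMBER (angles)**: a limit within each of the six open chambers at `0` is a limit within the injective angles. [cite: Rogawski1990, §8.4 p. 126] -/
theorem tendsto_nhdsWithin_injective_angles_of_forall_chamber (f : (Fin 3 → ℝ) → β) (l : Filter β)
    (h : ∀ σ : Equiv.Perm (Fin 3), Tendsto f (𝓝[{θ : Fin 3 → ℝ | θ (σ 0) < θ (σ 1) ∧ θ (σ 1) < θ (σ 2)}] (0 : Fin 3 → ℝ)) l) :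
    Tendsto f (𝓝[{θ : Fin 3 → ℝ | Function.Injective θ}] (0 : Fin 3 → ℝ)) l := by
  rw [setOf_injective_eq_iUnion_chamber, nhdsWithin_iUnion]
  exact tendsto_iSup.2 h

/-- **CHAMBER BY CHAMBER (the letter's filter)**: if `θ ↦ F(ζe^{iθ})` tends to `ℓ` as `θ → 0` within EACH of the six open chambers `{θ_{σ0} < θ_{σ1} < θ_{σ2}}`, then `F → ℓ` along
`𝓝[{z | Injective z}] (ζ,ζ,ζ)` — the regular angles are injective angles (`ζe^{iθ_i} = ζe^{iθ_j} ⇐ θ_i = θ_j`), and ED. 1's chart reduction.  The shape in which ROAD A's four compact-adjacent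
chambers ((A1′)–(A4)) and two doubly-noncompact chambers ((A5)) discharge ★ `ArchCentralLimitFormulaRankTwo`. [cite: Rogawski1990, §8.4 p. 126] -/
theorem tendsto_nhdsWithin_injective_of_forall_chamber (F : (Fin 3 → Circle) → β) (ζ : Circle) (l : Filter β)
    (h : ∀ σ : Equiv.Perm (Fin 3), Tendsto (fun θ : Fin 3 → ℝ => F (fun k : Fin 3 => ζ * Circle.exp (θ k)))
      (𝓝[{θ : Fin 3 → ℝ | θ (σ 0) < θ (σ 1) ∧ θ (σ 1) < θ (σ 2)}] (0 : Fin 3 → ℝ)) l) :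
    Tendsto F (𝓝[{z : Fin 3 → Circle | Function.Injective z}] (fun _ : Fin 3 => ζ)) l := by
  refine tendsto_nhdsWithin_injective_of_tendsto_angleChart F ζ l ?_
  refine (tendsto_nhdsWithin_injective_angles_of_forall_chamber _ l h).mono_left (nhdsWithin_mono _ fun θ hθ => ?_)
  intro i j hij
  exact hθ (by simp only [hij])

end Chambers

end Literature.NumberTheory.Rogawski1990

end
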